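import Mathlib.FieldTheory.IntermediateField.Adjoin.Basic
import Mathlib.FieldTheory.KummerPolynomial
import Mathlib.RingTheory.Derivation.Basic
import Mathlib.LinearAlgebra.Basis.Bilinear
import Mathlib.LinearAlgebra.FiniteDimensional.Lemmas
import Mathlib.Algebra.CharP.Algebra
import Mathlib.Algebra.CharP.Lemmas
import HarnessLib

/-!
# The derivation `d/dy` of a height-one purely inseparable simple extension `L = K(y)`, `y^p ∈ K`

Bridge material (lead c1 of crux `Pialt`, stmt-ResolutionOfSingularities-0555): for fields
`k → K → L` of characteristic `p` with `L = K(y)`, `y ∉ K`, `y ^ p = a ∈ K`, there is a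
`k`-derivation `D` of `L` with `D y = 1`, `D = 0` on `K`, `D^[p] = 0` and `ker D = K`
(Jacobson: `K = L^D` is the field of constants of the `p`-closed derivation `D = d/dy` of
`L ≅ K[X]/(X^p − a)`). Stated as an existence theorem (no new definition).
-/

set_option linter.dupNamespace false -- mandated namespace of this single-conjunct summit

noncomputable section

open Polynomial Module

namespace Summit.ResolutionOfSingularities.ResolutionOfSingularities.Theorems.Pialt.RadiciallyRegular

section HeightOne

variable {p : ℕ} [Fact p.Prime] {K L : Type} [Field K] [Field L] [Algebra K L] [CharP K p]

/-- In characteristic `p`, if `y ∉ K` and `y ^ p = a ∈ K` then `X ^ p - C a` is the minimal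
polynomial of `y` over `K`; in particular `y` is integral of degree `p`. [folklore] -/
theorem minpoly_eq_X_pow_sub_C_of_not_mem {y : L} (hyK : y ∉ (algebraMap K L).range) {a : K}
    (ha : algebraMap K L a = y ^ p) : minpoly K y = X ^ p - C a := by
  have hp : p.Prime := Fact.out
  haveI : CharP L p := charP_of_injective_algebraMap (algebraMap K L).injective p
  -- `a` is not a `p`-th power in `K`
  have hap : ∀ b : K, b ^ p ≠ a := by
    intro b hb
    apply hyK
    refine ⟨b, ?_⟩
    have h1 : (algebraMap K L b) ^ p = y ^ p := by rw [← map_pow, hb, ha]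
    have h2 : (algebraMap K L b - y) ^ p = 0 := by rw [sub_pow_char, h1, sub_self]
    exact (sub_eq_zero.mp (pow_eq_zero_iff (hp.ne_zero) |>.mp h2))
  have hirr : Irreducible (X ^ p - C a) := X_pow_sub_C_irreducible_of_prime hp hap
  have hmonic : (X ^ p - C a : K[X]).Monic := monic_X_pow_sub_C a hp.ne_zero
  symm
  refine minpoly.eq_of_irreducible_of_monic hirr ?_ hmonic
  simp [ha, sub_self]

/-- **The derivation `d/dy` of a height-one purely inseparable simple extension.** For fields
`k → K → L` of characteristic `p` with `L = K(y)`, `y ∉ K` and `y ^ p ∈ K`, there is a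
`k`-derivation `D` of `L` with `D y = 1`, vanishing on `K`, with `D^[p] = 0`, whose kernel is
exactly (the image of) `K`. Construction: `L` has the `K`-basis `1, y, …, y^{p-1}`
(`minpoly_eq_X_pow_sub_C_of_not_mem`); `D` is the `K`-linear map `y^i ↦ i y^{i-1}`, which
satisfies `D (y^n) = n y^{n-1}` for every `n` (as `y^p ∈ K` and `p = 0` in `L`), hence the
Leibniz rule (checked on basis pairs); `D^{i+1} (y^i) = 0` gives `D^[p] = 0`; and the kernel is
`K` by rank–nullity (`D (y^{j+1}) = (j+1) y^j` with `j + 1` invertible for `j + 1 < p`).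
[folklore] -/
theorem exists_derivation_heightOne (k : Type) [Field k] [Algebra k K] [Algebra k L]
    [IsScalarTower k K L] (y : L) (hyK : y ∉ (algebraMap K L).range)
    (hyp : y ^ p ∈ (algebraMap K L).range) (htop : IntermediateField.adjoin K {y} = ⊤) :
    ∃ D : Derivation k L L, D y = 1 ∧ (∀ x : K, D (algebraMap K L x) = 0) ∧
      (∀ x : L, (⇑D)^[p] x = 0) ∧ (∀ x : L, D x = 0 → x ∈ (algebraMap K L).range) := by
  classical
  obtain ⟨a, ha⟩ := hyp
  have hp : p.Prime := Fact.out
  haveI : CharP L p := charP_of_injective_algebraMap (algebraMap K L).injective p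
  have hmin := minpoly_eq_X_pow_sub_C_of_not_mem hyK ha
  have hint : IsIntegral K y := by
    refine ⟨X ^ p - C a, monic_X_pow_sub_C a hp.ne_zero, ?_⟩
    simp [ha]
  -- a power basis of `L` with generator `y` and dimension `p`
  let e : IntermediateField.adjoin K {y} ≃ₐ[K] L :=
    (IntermediateField.equivOfEq htop).trans IntermediateField.topEquiv
  let pb : PowerBasis K L := (IntermediateField.adjoin.powerBasis hint).map e
  have hgen : pb.gen = y := by
    simp [pb, e, IntermediateField.adjoin.powerBasis_gen]
  have hdim : pb.dim = p := by
    change (minpoly K y).natDegree = p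
    rw [hmin, natDegree_X_pow_sub_C]
  have hbasis : ∀ i : Fin pb.dim, pb.basis i = y ^ (i : ℕ) := fun i => by
    rw [pb.basis_eq_pow, hgen]
  -- the `K`-linear map `D₀ : y^i ↦ i y^{i-1}`
  let f : Fin pb.dim → L := fun i => ((i : ℕ) : L) * y ^ ((i : ℕ) - 1)
  let D₀ : L →ₗ[K] L := pb.basis.constr K f
  have hD₀b : ∀ i : Fin pb.dim, D₀ (y ^ (i : ℕ)) = ((i : ℕ) : L) * y ^ ((i : ℕ) - 1) := by
    intro i
    have h := pb.basis.constr_basis K f i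
    rwa [hbasis] at h
  have hya : y ^ p = algebraMap K L a := ha.symm
  have hpL : (p : L) = 0 := CharP.cast_eq_zero L p
  -- `D₀ (y^n) = n y^{n-1}` for every `n`
  have hD₀pow : ∀ n : ℕ, D₀ (y ^ n) = (n : L) * y ^ (n - 1) := by
    intro n
    induction n using Nat.strong_induction_on with
    | _ n ih =>
      by_cases hn : n < p
      · exact hD₀b ⟨n, hdim ▸ hn⟩
      · obtain ⟨m, rfl⟩ : ∃ m, n = m + p := ⟨n - p, by omega⟩
        have h1 : y ^ (m + p) = a • y ^ m := by
          rw [pow_add, hya, Algebra.smul_def, mul_comm]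
        rw [h1, map_smul, ih m (by have := hp.pos; omega)]
        rcases Nat.eq_zero_or_pos m with rfl | hm
        · simp
        · have h2 : m + p - 1 = (m - 1) + p := by omega
          rw [h2, pow_add, hya, Nat.cast_add, hpL, add_zero, Algebra.smul_def]
          ring
  have hD₀one : D₀ 1 = 0 := by
    have h := hD₀pow 0
    simpa using h
  -- the Leibniz rule, checked on basis pairs
  have hleib : ∀ u v : L, D₀ (u * v) = u * D₀ v + v * D₀ u := by
    let B₁ : L →ₗ[K] L →ₗ[K] L := (LinearMap.mul K L).compr₂ D₀
    let B₂ : L →ₗ[K] L →ₗ[K] L :=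
      (LinearMap.mul K L).compl₂ D₀ + ((LinearMap.mul K L).compl₂ D₀).flip
    have hB₁ : ∀ u v, B₁ u v = D₀ (u * v) := fun u v => rfl
    have hB₂ : ∀ u v, B₂ u v = u * D₀ v + v * D₀ u := fun u v => by
      simp only [B₂, LinearMap.add_apply, LinearMap.compl₂_apply, LinearMap.flip_apply,
        LinearMap.mul_apply']
    have hB : B₁ = B₂ := by
      refine LinearMap.ext_basis pb.basis pb.basis fun i j => ?_
      rw [hB₁, hB₂, hbasis, hbasis, ← pow_add, hD₀pow, hD₀pow, hD₀pow]
      rcases Nat.eq_zero_or_pos (i : ℕ) with hi | hi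
      · rw [hi]; simp
      rcases Nat.eq_zero_or_pos (j : ℕ) with hj | hj
      · rw [hj]; simp
      obtain ⟨i', hi'⟩ : ∃ i', (i : ℕ) = i' + 1 := ⟨(i : ℕ) - 1, by omega⟩
      obtain ⟨j', hj'⟩ : ∃ j', (j : ℕ) = j' + 1 := ⟨(j : ℕ) - 1, by omega⟩
      rw [hi', hj']
      have e1 : i' + 1 + (j' + 1) - 1 = i' + j' + 1 := by omega
      rw [e1, Nat.add_sub_cancel, Nat.add_sub_cancel]
      push_cast
      ring
    intro u v
    rw [← hB₁, ← hB₂, hB]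
  -- the derivation
  let D : Derivation k L L :=
    { toLinearMap := D₀.restrictScalars k
      map_one_eq_zero' := hD₀one
      leibniz' := fun u v => by
        change D₀ (u * v) = u • D₀ v + v • D₀ u
        rw [hleib, smul_eq_mul, smul_eq_mul] }
  have hDD₀ : ∀ x, D x = D₀ x := fun x => rfl
  have hDfun : (⇑D) = (⇑D₀) := funext hDD₀
  refine ⟨D, ?_, ?_, ?_, ?_⟩
  · -- `D y = 1`
    rw [hDD₀]
    have h := hD₀pow 1
    simpa using h
  · -- `D = 0` on `K`
    intro x
    rw [hDD₀, Algebra.algebraMap_eq_smul_one, map_smul, hD₀one, smul_zero]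
  · -- `D^[p] = 0`
    have hnil : ∀ i : ℕ, (D₀ ^ (i + 1)) (y ^ i) = 0 := by
      intro i
      induction i with
      | zero => simpa using hD₀one
      | succ i ih =>
        rw [pow_succ, Module.End.mul_apply, hD₀pow (i + 1), Nat.add_sub_cancel,
          show ((i + 1 : ℕ) : L) * y ^ i = ((i + 1 : ℕ) : K) • y ^ i by
            rw [Algebra.smul_def, map_natCast], map_smul, ih, smul_zero]
    have hzero : D₀ ^ p = 0 := by
      refine pb.basis.ext fun i => ?_
      rw [hbasis, LinearMap.zero_apply]
      have hi : (i : ℕ) + 1 ≤ p := by have h2 := i.2; omega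
      obtain ⟨m, hm⟩ : ∃ m, p = m + ((i : ℕ) + 1) := ⟨p - ((i : ℕ) + 1), by omega⟩
      rw [hm, pow_add, Module.End.mul_apply, hnil, map_zero]
    intro x
    rw [hDfun, ← Module.End.pow_apply, hzero, LinearMap.zero_apply]
  · -- `ker D = K`
    intro x hx
    rw [hDD₀] at hx
    haveI : FiniteDimensional K L := pb.finite
    -- `span K {1} = ker D₀` by rank–nullity
    have hp1 : 1 ≤ p := hp.one_lt.le
    have hle : (p - 1) ≤ pb.dim := by rw [hdim]; omega
    -- `y^0, …, y^{p-2}` lie in the range of `D₀`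
    have hrange : ∀ j : ℕ, j + 1 < p → y ^ j ∈ LinearMap.range D₀ := by
      intro j hj
      have hne : ((j + 1 : ℕ) : K) ≠ 0 := by
        rw [Ne, CharP.cast_eq_zero_iff K p]
        exact fun h => absurd (Nat.le_of_dvd (Nat.succ_pos j) h) (by omega)
      refine ⟨((j + 1 : ℕ) : K)⁻¹ • y ^ (j + 1), ?_⟩
      rw [map_smul, hD₀pow, Nat.add_sub_cancel,
        show ((j + 1 : ℕ) : L) * y ^ j = ((j + 1 : ℕ) : K) • y ^ j by
          rw [Algebra.smul_def, map_natCast], smul_smul, inv_mul_cancel₀ hne, one_smul]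
    -- a linearly independent family of `p - 1` vectors in the range
    let v : Fin (p - 1) → L := fun j => y ^ (j : ℕ)
    have hv : LinearIndependent K v := by
      have h := pb.basis.linearIndependent.comp (Fin.castLE hle) (Fin.castLE_injective hle)
      have hfun : (⇑pb.basis ∘ Fin.castLE hle) = v := by
        funext j
        simp [v, Function.comp, hbasis]
      rw [hfun] at h
      exact h
    have hspan_le : Submodule.span K (Set.range v) ≤ LinearMap.range D₀ := by
      rw [Submodule.span_le]
      rintro _ ⟨j, rfl⟩
      exact hrange j (by have := j.2; omega)
    have hfr : p - 1 ≤ Module.finrank K (LinearMap.range D₀) := by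
      have h := Submodule.finrank_mono hspan_le
      rwa [finrank_span_eq_card hv, Fintype.card_fin] at h
    have hrn := LinearMap.finrank_range_add_finrank_ker D₀
    rw [pb.finrank, hdim] at hrn
    have hker : Module.finrank K (LinearMap.ker D₀) ≤ 1 := by omega
    have hone : (1 : L) ∈ LinearMap.ker D₀ := by rw [LinearMap.mem_ker]; exact hD₀one
    have hspan1 : Submodule.span K {(1 : L)} ≤ LinearMap.ker D₀ :=
      (Submodule.span_singleton_le_iff_mem _ _).mpr hone
    have hfin1 : Module.finrank K (Submodule.span K {(1 : L)}) = 1 :=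
      finrank_span_singleton one_ne_zero
    have heq : Submodule.span K {(1 : L)} = LinearMap.ker D₀ :=
      Submodule.eq_of_le_of_finrank_le hspan1 (by rw [hfin1]; exact hker)
    have hxker : x ∈ LinearMap.ker D₀ := by rw [LinearMap.mem_ker]; exact hx
    rw [← heq, Submodule.mem_span_singleton] at hxker
    obtain ⟨c, rfl⟩ := hxker
    exact ⟨c, by rw [Algebra.algebraMap_eq_smul_one]⟩

end HeightOne

end Summit.ResolutionOfSingularities.ResolutionOfSingularities.Theorems.Pialt.RadiciallyRegular

end
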